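import Summits.QuantumFields.BalabanUV.Beta.EriceRemainderEnclosureHistoryAutonomyComparisonAgeCompositionYoungSingletonTower9
import Summits.QuantumFields.BalabanUV.Beta.EriceRemainderEnclosureHistoryAutonomyComparisonAgeCompositionYoungSecondTower9

/-!
# EriceRemainderEnclosureHistoryAutonomyComparisonAgeCompositionRatioNineThroughout — (E111j) route (N), first order: RATIO NINE THROUGHOUT — EVERY PROFILE WHOSE CONSECUTIVE AGES ARE
# IN RATIO AT LEAST NINE.  The floor of the pair-letter tower method (README g90 §6(e): with singleton levels and pair letters there is no finite-state invariant
# below ratio 9): **`flow_nonneg_ratio_nine`** — for EVERY youngest age `a_0 ≥ 1`, EVERY number `r` of ages `a_0 < a_1 < … < a_{r−1}` (`< K`, the profile vanishing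
# off them) with `9·a_j ≤ a_{j+1}` for every `j`, and NOTHING ELSE: `0 ≤ ε ≤ e` at every pin along every admissible flow, every horizon, every damping of the
# self-consistent class.  Cases: a lone age or an old second age `a_1 ≥ 58` — §1 **`flow_nonneg_tower9_old_second`** ((E111e) `flow_nonneg_census_tower9` for `a_0 = 1`
# ∕ (E111f) `flow_nonneg_young_singleton_tower9` for `a_0 ≥ 2`); a young second age `a_1 ≤ 57` — (E111i) `flow_nonneg_young_second_tower9`.  What ratio 9 cost over
# (E110h)'s ratio 10: the sharp pair letter `137∕200` on `(8,10]` ((E111a)), a 36-cell table with top value `7∕40` ((E111b–d)), the age-floor-9 young pair letter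
# `19∕25` on spans `≤ 12` ((E111g)) for the young second age, and the six-bracket bilinear closures (E111h).

Cell `pub-balaban`, β-function sub-cell, BINDER row D4 «RemainderConst leaves for Bałaban's split» (`HOME/BINDER-OWNERS.md`; owner lineage `b2b-balaban-beta-an4`;
this file by co-owner #2 lineage `b2b-balaban-beta-d4-p2`, generation 92), β-FLOW TEAM duty (1), FREEZE (0) honoured (def-free; nothing restated).

HONEST FRAMING (page 1, verbatim and binding).  *"Discharging BetaPertH makes Bałaban's UV stability UNCONDITIONAL — a real constructive-QFT result; it is
NOT the continuum limit and NOT the Clay problem."*  THIS FILE DISCHARGES NOTHING OF THE KIND.  Elementary real algebra ∕ real analysis about ABSTRACT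
functionals on a box ]0,γ]^ℕ with displayed floors, profiles and signs, and the FIRST-ORDER renewal objects of route (N) built from them — hypotheses of a
census, not facts; the form, signs, ages and moments of Bałaban's (1.22) limit functional are NOT PRINTED ([I] p. 298; GAPS G-t4-U2-1∕-2) and NOT asserted.
Row D4 class UNCHANGED (critical-path width 0; instance 0∕1; D4 DISCHARGE NO DATE).  HONEST DEPENDENCY: continuum YM on T⁴ ⇐ BetaPertH ∧ nine spine
estimates (0/9 proved); BetaPertH ⇐ (D1) ∧ (D4) ∧ CAP+tail; G-an2-4 gates asym, D1 and NE2/3/4.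

THE POINT (README `HOME/b2b-balaban-beta-d4-p2/g92/README.md` §1–§2).  Uses (E111e) `flow_nonneg_census_tower9`, (E111f) `flow_nonneg_young_singleton_tower9`, (E111i)
`flow_nonneg_young_second_tower9` BY NAME.  NOT CLAIMED: any ratio below 9 (first order; the method's floor); arbitrary dampings in `]0,1]` outside the
self-consistent class; anything nonlinear; anything printed — NOT B12 Thm 2, NOT BetaPertH, NOT continuum, NOT Clay.

WHAT IS PROVED ([folklore]; 0 `def`, 0 sorry).  §1 **`flow_nonneg_tower9_old_second`**.  §2 **`flow_nonneg_ratio_nine`**.  §3 **`flow_nonneg_four_ages_ratio_nine`**,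
**`flow_nonneg_five_ages_ratio_nine`**.
-/
noncomputable section
open Finset

namespace Summit.QuantumFields.BalabanUV.Beta.EriceRemainderEnclosureHistoryAutonomyComparisonAgeCompositionRatioNineThroughout

open Literature.MathematicalPhysics.QuantumFieldTheory.Balaban1983to89
open Literature.MathematicalPhysics.QuantumFieldTheory.Balaban1983to89.T4BetaStationary
open Literature.MathematicalPhysics.QuantumFieldTheory.Balaban1983to89.T4BetaFlowWellPosed
open Summit.QuantumFields.BalabanUV.Beta.EriceRemainderEnclosureHistoryAutonomyComparisonAgeCompositionTower9 (flow_nonneg_census_tower9)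
open Summit.QuantumFields.BalabanUV.Beta.EriceRemainderEnclosureHistoryAutonomyComparisonAgeCompositionYoungSingletonTower9 (flow_nonneg_young_singleton_tower9)
open Summit.QuantumFields.BalabanUV.Beta.EriceRemainderEnclosureHistoryAutonomyComparisonAgeCompositionYoungSecondTower9 (flow_nonneg_young_second_tower9)

variable {B : (ℕ → ℝ) → ℝ} {γ b gIR : ℝ} {L : ℕ → ℝ} {K : ℕ} {h g : ℕ → ℝ}

/-! ## §1 A lone age or an old second age -/

/-- **RATIO NINE WITH AN OLD SECOND AGE, ANY YOUNGEST AGE.**  Ages `a_0 < a_1 < … < a_{r−1}` (`r ≥ 1`) with `1 ≤ a_0` (ANY), `58 ≤ a_1` (OLD), `9a_j ≤ a_{j+1}`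
for EVERY `j ≥ 0` (including the first ratio), all `< K`, the profile vanishing off them: `0 ≤ ε ≤ e` at every pin — (E111e) for `a_0 = 1`, (E111f) for
`a_0 ≥ 2`. [folklore] -/
theorem flow_nonneg_tower9_old_second
    (hmono : ∀ u v : ℕ → ℝ, SeqBox γ u → SeqBox γ v → (∀ j, u j ≤ v j) → B u ≤ B v)
    (hL : ∀ k, 0 ≤ L k) (hb : 0 < b) (hlo : ∀ u, SeqBox γ u → b ≤ B u) (hdom : ∀ u, SeqBox γ u → ∑ k ∈ range K, L k * u k ≤ B u)
    (hh : SeqBox γ h) (hf : MemFlow B gIR h) (hg : ∀ t, 0 < g t ∧ g t ≤ 1)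
    (hgF : ∀ t, 1 ≤ g t * (1 + ∑ k ∈ range K, L k * h (t + k) ^ 3 / 2))
    {r : ℕ} {a : ℕ → ℕ} (hr : 1 ≤ r) (ha0 : 1 ≤ a 0) (ha1 : 1 < r → 58 ≤ a 1)
    (haR : ∀ j, j + 1 < r → 9 * a j ≤ a (j + 1)) (haK : ∀ j, j < r → a j < K)
    (hLa : ∀ l, l < K → (∀ j, j < r → l ≠ a j) → L l = 0)
    {N : ℕ} {KL : ℕ → ℕ → ℕ → ℝ}
    (hKL : ∀ k n l, KL k n l = if 0 < k ∧ k < K ∧ l < k then L k * h (n + k) ^ 3 / 2 * ∏ t ∈ Ico (n + 1 + l) (n + k + 1), g t else 0)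
    {KA : ℕ → ℕ → ℕ → ℝ} {RA : ℕ → (ℕ → ℝ) → ℕ → ℝ}
    (hRA : ∀ i v m, RA i v m = ∑ l ∈ range K, KA i m l * v (m + 1 + l))
    (hKA : ∀ i m l, KA i m l = KL i m l + KA (i + 1) m l) (hKAtop : ∀ m l, KA K m l = 0)
    {e ε : ℕ → ℝ} (he0 : ∀ m, 0 ≤ e m) (hea : ∀ m, e (m + 1) ≤ e m)
    (hεt : ∀ m, N < m → ε m = 0) (hεrec : ∀ m, ε m = e m - RA 1 ε m) : ∀ m, 0 ≤ ε m ∧ ε m ≤ e m := by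
  rcases Nat.lt_or_ge 1 (a 0) with h2 | h2
  · exact flow_nonneg_young_singleton_tower9 hmono hL hb hlo hdom hh hf hg hgF hr h2 ha1 haR haK hLa hKL hRA hKA hKAtop he0 hea hεt hεrec
  · exact flow_nonneg_census_tower9 hmono hL hb hlo hdom hh hf hg hgF hr (by omega) ha1 (fun j _ hjr => haR j hjr) haK hLa hKL hRA hKA hKAtop
      he0 hea hεt hεrec

/-! ## §2 Ratio nine throughout -/

/-- **RATIO NINE THROUGHOUT — EVERY YOUNGEST AGE, EVERY NUMBER OF AGES, NO OTHER CONDITION.**  `B` an isotone memory with floor `b > 0` dominating the profile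
`L ≥ 0`, `h` a box solution, `g` a damping of the self-consistent class `g_t(1 + F_t) ≥ 1`, the route-(N) renewal objects `KL, KA, RA`, the excess `e ≥ 0`
non-increasing, `ε` the zero-tailed solution of `ε = e − RA 1 ε`.  Ages `a_0 < a_1 < … < a_{r−1}` (`r ≥ 1`) with `1 ≤ a_0` and `9·a_j ≤ a_{j+1}` for every `j`,
all `< K`, the profile vanishing off them.  THEN `0 ≤ ε ≤ e` at every pin. [folklore] -/
theorem flow_nonneg_ratio_nine
    (hmono : ∀ u v : ℕ → ℝ, SeqBox γ u → SeqBox γ v → (∀ j, u j ≤ v j) → B u ≤ B v)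
    (hL : ∀ k, 0 ≤ L k) (hb : 0 < b) (hlo : ∀ u, SeqBox γ u → b ≤ B u) (hdom : ∀ u, SeqBox γ u → ∑ k ∈ range K, L k * u k ≤ B u)
    (hh : SeqBox γ h) (hf : MemFlow B gIR h) (hg : ∀ t, 0 < g t ∧ g t ≤ 1)
    (hgF : ∀ t, 1 ≤ g t * (1 + ∑ k ∈ range K, L k * h (t + k) ^ 3 / 2))
    {r : ℕ} {a : ℕ → ℕ} (hr : 1 ≤ r) (ha0 : 1 ≤ a 0)
    (haR : ∀ j, j + 1 < r → 9 * a j ≤ a (j + 1)) (haK : ∀ j, j < r → a j < K)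
    (hLa : ∀ l, l < K → (∀ j, j < r → l ≠ a j) → L l = 0)
    {N : ℕ} {KL : ℕ → ℕ → ℕ → ℝ}
    (hKL : ∀ k n l, KL k n l = if 0 < k ∧ k < K ∧ l < k then L k * h (n + k) ^ 3 / 2 * ∏ t ∈ Ico (n + 1 + l) (n + k + 1), g t else 0)
    {KA : ℕ → ℕ → ℕ → ℝ} {RA : ℕ → (ℕ → ℝ) → ℕ → ℝ}
    (hRA : ∀ i v m, RA i v m = ∑ l ∈ range K, KA i m l * v (m + 1 + l))
    (hKA : ∀ i m l, KA i m l = KL i m l + KA (i + 1) m l) (hKAtop : ∀ m l, KA K m l = 0)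
    {e ε : ℕ → ℝ} (he0 : ∀ m, 0 ≤ e m) (hea : ∀ m, e (m + 1) ≤ e m)
    (hεt : ∀ m, N < m → ε m = 0) (hεrec : ∀ m, ε m = e m - RA 1 ε m) : ∀ m, 0 ≤ ε m ∧ ε m ≤ e m := by
  rcases Nat.lt_or_ge 1 r with h1r | h1r
  · rcases le_or_gt 58 (a 1) with hold | hyoung
    · exact flow_nonneg_tower9_old_second hmono hL hb hlo hdom hh hf hg hgF hr ha0 (fun _ => hold) haR haK hLa hKL hRA hKA hKAtop he0 hea hεt hεrec
    · exact flow_nonneg_young_second_tower9 hmono hL hb hlo hdom hh hf hg hgF (by omega) ha0 (by omega) haR haK hLa hKL hRA hKA hKAtop he0 hea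
        hεt hεrec
  · exact flow_nonneg_tower9_old_second hmono hL hb hlo hdom hh hf hg hgF hr ha0 (fun h => absurd h (by omega)) haR haK hLa hKL hRA hKA hKAtop
      he0 hea hεt hεrec

/-! ## §3 Census corollaries -/

/-- **FOUR AGES AT RATIO NINE.**  Ages `1 ≤ k₁` (ANY), `9k₁ ≤ k₂`, `9k₂ ≤ k₃`, `9k₃ ≤ k₄ < K`, the profile vanishing off them: `0 ≤ ε ≤ e` at every pin, every
horizon, every damping of the self-consistent class. [folklore] -/
theorem flow_nonneg_four_ages_ratio_nine
    (hmono : ∀ u v : ℕ → ℝ, SeqBox γ u → SeqBox γ v → (∀ j, u j ≤ v j) → B u ≤ B v)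
    (hL : ∀ k, 0 ≤ L k) (hb : 0 < b) (hlo : ∀ u, SeqBox γ u → b ≤ B u) (hdom : ∀ u, SeqBox γ u → ∑ k ∈ range K, L k * u k ≤ B u)
    (hh : SeqBox γ h) (hf : MemFlow B gIR h) (hg : ∀ t, 0 < g t ∧ g t ≤ 1)
    (hgF : ∀ t, 1 ≤ g t * (1 + ∑ k ∈ range K, L k * h (t + k) ^ 3 / 2))
    {k₁ k₂ k₃ k₄ : ℕ} (hk1 : 1 ≤ k₁) (hk2 : 9 * k₁ ≤ k₂) (hk3 : 9 * k₂ ≤ k₃) (hk4 : 9 * k₃ ≤ k₄) (hk4K : k₄ < K)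
    (hL4 : ∀ j, j < K → j ≠ k₁ → j ≠ k₂ → j ≠ k₃ → j ≠ k₄ → L j = 0)
    {N : ℕ} {KL : ℕ → ℕ → ℕ → ℝ}
    (hKL : ∀ k n l, KL k n l = if 0 < k ∧ k < K ∧ l < k then L k * h (n + k) ^ 3 / 2 * ∏ t ∈ Ico (n + 1 + l) (n + k + 1), g t else 0)
    {KA : ℕ → ℕ → ℕ → ℝ} {RA : ℕ → (ℕ → ℝ) → ℕ → ℝ}
    (hRA : ∀ i v m, RA i v m = ∑ l ∈ range K, KA i m l * v (m + 1 + l))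
    (hKA : ∀ i m l, KA i m l = KL i m l + KA (i + 1) m l) (hKAtop : ∀ m l, KA K m l = 0)
    {e ε : ℕ → ℝ} (he0 : ∀ m, 0 ≤ e m) (hea : ∀ m, e (m + 1) ≤ e m)
    (hεt : ∀ m, N < m → ε m = 0) (hεrec : ∀ m, ε m = e m - RA 1 ε m) : ∀ m, 0 ≤ ε m ∧ ε m ≤ e m := by
  refine flow_nonneg_ratio_nine hmono hL hb hlo hdom hh hf hg hgF (r := 4)
    (a := fun j => if j = 0 then k₁ else if j = 1 then k₂ else if j = 2 then k₃ else k₄) (by norm_num) (by simpa using hk1)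
    (fun j hjr => ?_) (fun j hj => ?_) (fun l hl hla => hL4 l hl ?_ ?_ ?_ ?_) hKL hRA hKA hKAtop he0 hea hεt hεrec
  · have : j = 0 ∨ j = 1 ∨ j = 2 := by omega
    rcases this with rfl | rfl | rfl <;> simpa
  · have : j = 0 ∨ j = 1 ∨ j = 2 ∨ j = 3 := by omega
    rcases this with rfl | rfl | rfl | rfl <;> simp <;> omega
  · simpa using hla 0 (by norm_num)
  · simpa using hla 1 (by norm_num)
  · simpa using hla 2 (by norm_num)
  · simpa using hla 3 (by norm_num)

/-- **FIVE AGES AT RATIO NINE.**  Ages `1 ≤ k₁` (ANY), `9k_i ≤ k_{i+1}` (`i = 1, …, 4`), `k₅ < K`, the profile vanishing off them: `0 ≤ ε ≤ e` at every pin. [folklore] -/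
theorem flow_nonneg_five_ages_ratio_nine
    (hmono : ∀ u v : ℕ → ℝ, SeqBox γ u → SeqBox γ v → (∀ j, u j ≤ v j) → B u ≤ B v)
    (hL : ∀ k, 0 ≤ L k) (hb : 0 < b) (hlo : ∀ u, SeqBox γ u → b ≤ B u) (hdom : ∀ u, SeqBox γ u → ∑ k ∈ range K, L k * u k ≤ B u)
    (hh : SeqBox γ h) (hf : MemFlow B gIR h) (hg : ∀ t, 0 < g t ∧ g t ≤ 1)
    (hgF : ∀ t, 1 ≤ g t * (1 + ∑ k ∈ range K, L k * h (t + k) ^ 3 / 2))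
    {k₁ k₂ k₃ k₄ k₅ : ℕ} (hk1 : 1 ≤ k₁) (hk2 : 9 * k₁ ≤ k₂) (hk3 : 9 * k₂ ≤ k₃) (hk4 : 9 * k₃ ≤ k₄) (hk5 : 9 * k₄ ≤ k₅) (hk5K : k₅ < K)
    (hL5 : ∀ j, j < K → j ≠ k₁ → j ≠ k₂ → j ≠ k₃ → j ≠ k₄ → j ≠ k₅ → L j = 0)
    {N : ℕ} {KL : ℕ → ℕ → ℕ → ℝ}
    (hKL : ∀ k n l, KL k n l = if 0 < k ∧ k < K ∧ l < k then L k * h (n + k) ^ 3 / 2 * ∏ t ∈ Ico (n + 1 + l) (n + k + 1), g t else 0)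
    {KA : ℕ → ℕ → ℕ → ℝ} {RA : ℕ → (ℕ → ℝ) → ℕ → ℝ}
    (hRA : ∀ i v m, RA i v m = ∑ l ∈ range K, KA i m l * v (m + 1 + l))
    (hKA : ∀ i m l, KA i m l = KL i m l + KA (i + 1) m l) (hKAtop : ∀ m l, KA K m l = 0)
    {e ε : ℕ → ℝ} (he0 : ∀ m, 0 ≤ e m) (hea : ∀ m, e (m + 1) ≤ e m)
    (hεt : ∀ m, N < m → ε m = 0) (hεrec : ∀ m, ε m = e m - RA 1 ε m) : ∀ m, 0 ≤ ε m ∧ ε m ≤ e m := by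
  refine flow_nonneg_ratio_nine hmono hL hb hlo hdom hh hf hg hgF (r := 5)
    (a := fun j => if j = 0 then k₁ else if j = 1 then k₂ else if j = 2 then k₃ else if j = 3 then k₄ else k₅) (by norm_num) (by simpa using hk1)
    (fun j hjr => ?_) (fun j hj => ?_) (fun l hl hla => hL5 l hl ?_ ?_ ?_ ?_ ?_) hKL hRA hKA hKAtop he0 hea hεt hεrec
  · have : j = 0 ∨ j = 1 ∨ j = 2 ∨ j = 3 := by omega
    rcases this with rfl | rfl | rfl | rfl <;> simpa
  · have : j = 0 ∨ j = 1 ∨ j = 2 ∨ j = 3 ∨ j = 4 := by omega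
    rcases this with rfl | rfl | rfl | rfl | rfl <;> simp <;> omega
  · simpa using hla 0 (by norm_num)
  · simpa using hla 1 (by norm_num)
  · simpa using hla 2 (by norm_num)
  · simpa using hla 3 (by norm_num)
  · simpa using hla 4 (by norm_num)

end Summit.QuantumFields.BalabanUV.Beta.EriceRemainderEnclosureHistoryAutonomyComparisonAgeCompositionRatioNineThroughout

end
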